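import Literature.Computability.AlgebraicComplexity.IP17HookRectangleKronecker
import HarnessLib

/-!
# Pieri's rule for the characters of the symmetric groups (branching to a Young subgroup
# `𝔖_a × 𝔖_b` against the trivial character of `𝔖_b`)

Topic `Literature/RepresentationTheory/FiniteGroups`. For a partition `π ⊢ D`, a splitting
`e : [a] ⊔ [b] ≃ [D]` of the positions (so `D = a + b`) and `σ ∈ 𝔖_a`,

  `∑_{ρ ∈ 𝔖_b} χ^π(e ∘ (σ ⊔ ρ) ∘ e⁻¹) = b! · ∑_{π' ⊢ a, π/π' a horizontal strip} χ^{π'}(σ)`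

(`sum_spechtCharacter_permCongr_sumCongr`): the multiplicity of `[π'] ⊠ 1_{𝔖_b}` in the
restriction of the Specht module `[π]` to the Young subgroup `𝔖_a × 𝔖_b` is `1` if `π/π'` is a
horizontal strip (`π₁ ≥ π'₁ ≥ π₂ ≥ π'₂ ≥ ⋯`, "`π ↦ π'`" in the notation of Bürgisser–Landsberg–
Manivel–Weyman 2011, Prop. 4.5.4) and `0` otherwise — **Pieri's rule** `[π'] ∘ [b] = ∑_{π/π' horizontal
b-strip} [π]` (Macdonald, *Symmetric Functions and Hall Polynomials*, Ch. I (5.16) with (7.3):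
`s_{π'} h_b = ∑ s_π` and `ch(Ind_{𝔖_a × 𝔖_b}([π'] ⊠ 1)) = s_{π'} h_b`; Fulton–Harris, *Representation
Theory*, (4.41)–(4.44) and Ex. 4.44 / Cor. 4.39; James, LNM 682, 17.14 in the Young-rule form),
here in its pointwise character form, which by Frobenius reciprocity is the displayed identity.

## Proof (Frobenius's formula; no Littlewood–Richardson theory)

With the tree's Frobenius formula `χ^π(τ) = [x^{π+ρ}](a_ρ · F_τ)` in `N ≥ ℓ(π)` letters
(`spechtCharacter_eq_frobeniusChar`, `F_τ` the fixed-word enumerator `∏_{cycles} p_{|c|}`):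
1. `F_{σ ⊔ ρ} = F_σ F_ρ` (`fixedWordPoly_sumCongr`: a word on `[a] ⊔ [b]` is a pair of words).
2. `∑_{ρ ∈ 𝔖_b} F_ρ = b! · h_b` with `h_b = ∑_{|c| = b} x^c` (`sum_fixedWordPoly_eq_factorial_mul`:
   orbit–stabilizer over the words of each content, `sum_card_stab_eq_factorial_of_content`).
3. `a_ρ F_σ = ∑_γ χ^γ(σ) a_{γ+ρ}` (the tree's alternant expansion `alternant_mul_fixedWordPoly_eq_sum`).
4. `[x^{π+ρ}](a_{γ+ρ} h_b) = ∑_{w ∈ 𝔖_N} sgn(w) [w(γ+ρ) ≤ π+ρ]` (`coeff_alternant_add_rho_mul_hsum`)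
   and this signed count is the determinant of the staircase `0/1` matrix
   `M_{ij} = [(γ+ρ)_j ≤ (π+ρ)_i]`, which is `1` if `π/γ` is a horizontal strip (then `M` is upper
   unitriangular) and `0` otherwise (two equal rows or a zero row) — `sum_sign_mul_ite_le_eq`.
5. Re-indexing the antitone weights `γ ∈ ℕ^N`, `|γ| = a`, by partitions of `a`
   (`Weight.ofPartition`, Frobenius again for `χ^{π'}`).

Honest framing (cell `val-lit`, seat t03): classical character theory of `𝔖_n`; consumed by the
padded-permanent computation of BLMW 2011 Prop. 5.6.2. Nothing here bears on VP versus VNP.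
No definitions, no named facts.

## References

* [Macdonald1995] I. G. Macdonald, *Symmetric Functions and Hall Polynomials*, 2nd ed. (1995),
  Ch. I §5 (5.16) (Pieri's formula), §7 (7.3), (7.8) (Frobenius characteristic, `h_b = ch(1_{𝔖_b})`).
* [FultonHarrisGTM129] W. Fulton, J. Harris, *Representation Theory*, GTM 129 (1991), Thm. 4.10,
  §4.3 (4.41)–(4.44), Cor. 4.39 (Young's rule / Pieri).
* [JamesLNM682] G. D. James, *The Representation Theory of the Symmetric Groups*, LNM 682, §17
  (17.14, Young's rule) and §9 (the branching theorem, the case `b = 1`).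
* [BurgisserEtAl2011] P. Bürgisser, J. M. Landsberg, L. Manivel, J. Weyman, SIAM J. Comput. 40
  (2011), Prop. 4.5.4 (the interlacing notation `π ↦ π'`), Def. 5.6.1 (consumer).

## Mathlib and tree

Mathlib: `Matrix.det_apply`, `Matrix.det_of_upperTriangular`, `Matrix.det_zero_of_row_eq`,
`Matrix.det_eq_zero_of_row_eq_zero`, `Fin.coe_orderIso_apply`, `StrictMono.orderIsoOfSurjective`,
`Equiv.Perm.sumCongr`, `Equiv.permCongr`, `MvPolynomial.coeff_mul_monomial'`. Tree:
`fixedWordPoly`, `frobeniusChar`, `frobeniusChar_permCongr`, `coeff_alternant_mul`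
(`SymmetricGroupFixedWords`); `sum_perm_sum_fixed_eq`, `sum_card_stab_eq_factorial_of_content`
(`SymmetricGroupFrobeniusOrthogonality`); `spechtCharacter_eq_frobeniusChar`,
`getD_sortedParts_antitone`, `sum_getD_sortedParts` (`SymmetricGroupFrobeniusFormula`);
`alternant_mul_fixedWordPoly_eq_sum` (`IP17HookRectangleKronecker`); `antitoneWeights`,
`mem_antitoneWeights`, `rho`, `strictAnti_add_rho` (`SchurPolynomials`);
`Weight.ofPartition_injOn_holds`, `Weight.existsUnique_eq_ofPartition_holds` (`GLHighestWeightFacts`).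
-/

noncomputable section

open scoped BigOperators
open MvPolynomial Finset Equiv
open Literature.RingTheory.SymmetricFunctions.SymmPoly
open Literature.NumberTheory.DiophantineGeometry
open Literature.Computability.AlgebraicComplexity (alternant_mul_fixedWordPoly_eq_sum)

namespace Literature.RepresentationTheory.FiniteGroups

/-! ### §1 The fixed-word enumerator of a block permutation -/

section Block

variable {ι κ : Type*} [Fintype ι] [DecidableEq ι] [Fintype κ] [DecidableEq κ] {N : ℕ}

/-- **`F_{σ ⊔ ρ} = F_σ · F_ρ`**: a word on the disjoint union `ι ⊔ κ` fixed by `σ ⊔ ρ` is a pair of a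
word on `ι` fixed by `σ` and a word on `κ` fixed by `ρ` (the cycle type of `σ ⊔ ρ` is the union of the
cycle types; Fulton–Harris §4.1, `P_𝐢 P_𝐣 = P_{𝐢+𝐣}`). [cite: FultonHarrisGTM129, §4.1 (4.10)] -/
theorem fixedWordPoly_sumCongr (σ : Perm ι) (ρ : Perm κ) :
    fixedWordPoly N (σ.sumCongr ρ) = fixedWordPoly N σ * fixedWordPoly N ρ := by
  unfold fixedWordPoly
  rw [Finset.sum_filter, Finset.sum_filter, Finset.sum_filter, Finset.sum_mul_sum,
    ← Finset.sum_product', Finset.univ_product_univ,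
    ← (Equiv.sumArrowEquivProdArrow ι κ (Fin N)).sum_comp]
  refine Finset.sum_congr rfl fun w _ => ?_
  have h1 : (Equiv.sumArrowEquivProdArrow ι κ (Fin N) w).1 = w ∘ Sum.inl := rfl
  have h2 : (Equiv.sumArrowEquivProdArrow ι κ (Fin N) w).2 = w ∘ Sum.inr := rfl
  rw [h1, h2, ite_zero_mul_ite_zero, Fintype.prod_sum_type]
  have hiff : w ∘ ⇑(σ.sumCongr ρ) = w ↔ (w ∘ Sum.inl) ∘ ⇑σ = w ∘ Sum.inl ∧
      (w ∘ Sum.inr) ∘ ⇑ρ = w ∘ Sum.inr := by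
    constructor
    · intro h
      exact ⟨funext fun i => by simpa using congr_fun h (Sum.inl i),
        funext fun j => by simpa using congr_fun h (Sum.inr j)⟩
    · rintro ⟨h₁, h₂⟩
      funext p
      rcases p with i | j
      · simpa using congr_fun h₁ i
      · simpa using congr_fun h₂ j
  by_cases h : w ∘ ⇑(σ.sumCongr ρ) = w
  · rw [if_pos h, if_pos (hiff.mp h)]
    rfl
  · rw [if_neg h, if_neg (fun h' => h (hiff.mpr h'))]

end Block

/-! ### §2 `∑_{ρ ∈ 𝔖_b} F_ρ = b! · h_b` -/

section SumPerm

variable {N : ℕ}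

/-- The content of a word of length `b` has degree `b` (lies in the antidiagonal of `b`).
[folklore] -/
private theorem wordExps_mem_finsuppAntidiag {b : ℕ} (w : Fin b → Fin N) :
    wordExps N w ∈ (univ : Finset (Fin N)).finsuppAntidiag b := by
  rw [Finset.mem_finsuppAntidiag]
  refine ⟨?_, Finset.subset_univ _⟩
  simp only [wordExps_apply]
  rw [sum_card_filter_eq_card, Fintype.card_fin]

/-- **`∑_{ρ ∈ 𝔖_b} F_ρ(x) = b! · h_b(x)`** at the generic point, `h_b = ∑_{|c| = b} x^c` the complete
homogeneous symmetric polynomial: grouping the fixed words by content, each content class (one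
`𝔖_b`-orbit) contributes `∑_{cont w = c} |Stab w| = b!` (`sum_card_stab_eq_factorial_of_content`).
This is `h_b = ∑_{|ρ| = b} z_ρ⁻¹ p_ρ` (Macdonald I (2.14')), i.e. `h_b` is the Frobenius characteristic
of the trivial character of `𝔖_b` (Macdonald I (7.3)). [cite: Macdonald1995, Ch. I §2 (2.14') and §7 (7.3)] -/
theorem sum_fixedWordPoly_eq_factorial_mul (b N : ℕ) :
    ∑ ρ : Perm (Fin b), fixedWordPoly N ρ =
      C (b.factorial : ℤ) * ∑ c ∈ (univ : Finset (Fin N)).finsuppAntidiag b, monomial c 1 := by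
  simp_rw [fixedWordPoly_eq_sum_monomial]
  rw [sum_perm_sum_fixed_eq (f := fun w : Fin b → Fin N => (monomial (wordExps N w) (1 : ℤ)))]
  rw [Finset.mul_sum]
  symm
  rw [← Finset.sum_fiberwise_of_maps_to (s := (univ : Finset (Fin b → Fin N)))
    (t := (univ : Finset (Fin N)).finsuppAntidiag b) (g := wordExps N)
    (fun w _ => wordExps_mem_finsuppAntidiag w)]
  refine Finset.sum_congr rfl fun c hc => ?_
  have hterm : ∀ w ∈ univ.filter (fun w : Fin b → Fin N => wordExps N w = c),
      (univ.filter fun σ : Perm (Fin b) => w ∘ ⇑σ = w).card • (monomial (wordExps N w) (1 : ℤ)) =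
        (univ.filter fun σ : Perm (Fin b) => w ∘ ⇑σ = w).card • (monomial c (1 : ℤ)) := by
    intro w hw
    rw [(Finset.mem_filter.mp hw).2]
  rw [Finset.sum_congr rfl hterm, ← Finset.sum_smul]
  have hM : ∑ a, c a = Fintype.card (Fin b) := by
    rw [Fintype.card_fin]
    have := (Finset.mem_finsuppAntidiag.mp hc).1
    simpa using this
  have hcount : ∑ w ∈ univ.filter (fun w : Fin b → Fin N => wordExps N w = c),
      (univ.filter fun σ : Perm (Fin b) => w ∘ ⇑σ = w).card = b.factorial := by
    have h0 := sum_card_stab_eq_factorial_of_content (ι := Fin b) (α := Fin N) (fun a => c a) hM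
    rw [Fintype.card_fin] at h0
    rw [← h0]
    refine Finset.sum_congr ?_ (fun _ _ => rfl)
    ext u
    simp only [Finset.mem_filter, Finset.mem_univ, true_and]
    constructor
    · intro h a
      rw [← h, wordExps_apply]
    · intro h
      ext a
      rw [wordExps_apply, h a]
  rw [hcount, MvPolynomial.C_mul', ← Nat.cast_smul_eq_nsmul ℤ]

end SumPerm

/-! ### §3 The staircase determinant: `∑_w sgn(w) [w(γ+ρ) ≤ λ+ρ] = [λ/γ is a horizontal strip]` -/

section Staircase

variable {N : ℕ}

/-- A lower set of `Fin N` is the initial segment of its own cardinality. [folklore] -/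
private theorem mem_iff_lt_card_of_lower (T : Finset (Fin N))
    (hT : ∀ ⦃j j' : Fin N⦄, j' ≤ j → j ∈ T → j' ∈ T) (j : Fin N) : j ∈ T ↔ (j : ℕ) < T.card := by
  constructor
  · intro hj
    have hsub : Finset.Iic j ⊆ T := fun j' hj' => hT (Finset.mem_Iic.mp hj') hj
    have := Finset.card_le_card hsub
    rw [Fin.card_Iic] at this
    omega
  · intro hlt
    by_contra hj
    have hsub : T ⊆ Finset.Iio j := by
      intro j' hj'
      rw [Finset.mem_Iio]
      by_contra hle
      exact hj (hT (not_lt.mp hle) hj')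
    have := Finset.card_le_card hsub
    rw [Fin.card_Iio] at this
    omega

/-- The number of entries of a strictly decreasing `v` exceeding a threshold `t`; the entries `≤ t`
are exactly those of index at least this number. [folklore] -/
private theorem le_iff_card_filter_le {v : Fin N → ℕ} (hv : StrictAnti v) (t : ℕ) (j : Fin N) :
    v j ≤ t ↔ (univ.filter fun j' : Fin N => t < v j').card ≤ (j : ℕ) := by
  have h := mem_iff_lt_card_of_lower (univ.filter fun j' : Fin N => t < v j')
    (fun j j' hjj' hj => by
      rw [Finset.mem_filter] at hj ⊢
      exact ⟨Finset.mem_univ _, lt_of_lt_of_le hj.2 (hv.antitone hjj')⟩) j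
  rw [Finset.mem_filter] at h
  simp only [Finset.mem_univ, true_and] at h
  constructor
  · intro hle
    by_contra hlt
    exact absurd (h.mpr (not_le.mp hlt)) (not_lt.mpr hle)
  · intro hle
    by_contra hlt
    exact absurd (h.mp (not_le.mp hlt)) (not_lt.mpr hle)

/-- A strictly monotone self-map of `Fin N` is the identity. [folklore] -/
private theorem eq_self_of_strictMono {c : Fin N → Fin N} (hc : StrictMono c) (i : Fin N) :
    (c i : ℕ) = i := by
  have hsurj : Function.Surjective c := Finite.surjective_of_injective hc.injective
  exact Fin.coe_orderIso_apply (hc.orderIsoOfSurjective c hsurj) i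

/-- **The staircase determinant.** For antitone `γ, λ ∈ ℕ^N` (so `γ + ρ`, `λ + ρ` strictly
decreasing, `ρ = (N-1, …, 0)`): `∑_{w ∈ 𝔖_N} sgn(w) · [(γ+ρ) ∘ w⁻¹ ≤ λ + ρ pointwise] = 1` if
`γ_i ≤ λ_i` and `λ_{i+1} ≤ γ_i` for all `i` (the diagram of `γ` sits in that of `λ` and `λ/γ` has at
most one box in each column — a horizontal strip, `λ ↦ γ`), and `= 0` otherwise. The sum is the
determinant of `M_{ij} = [(γ+ρ)_j ≤ (λ+ρ)_i]`, whose rows are indicator vectors of final segments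
`{j ≥ c_i}` with `c` weakly increasing; it is upper unitriangular exactly in the interlacing case and
has two equal rows or a zero row otherwise. This is the coefficient computation behind Pieri's
formula `a_{γ+ρ} h_b = ∑ a_{λ+ρ}` (Macdonald I (5.16)). [cite: Macdonald1995, Ch. I §5 (5.16)] -/
theorem sum_sign_mul_ite_le_eq {γ lam : Fin N → ℕ} (hγ : Antitone γ) (hlam : Antitone lam) :
    ∑ τ : Perm (Fin N), (Equiv.Perm.sign τ : ℤ) *
        (if ∀ j, (γ + rho N) (τ⁻¹ j) ≤ (lam + rho N) j then 1 else 0) =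
      if (∀ i : Fin N, γ i ≤ lam i ∧ ∀ i' : Fin N, (i : ℕ) + 1 = i' → lam i' ≤ γ i) then 1 else 0 := by
  classical
  set u : Fin N → ℕ := lam + rho N with hu
  set v : Fin N → ℕ := γ + rho N with hv
  have hus : StrictAnti u := strictAnti_add_rho hlam
  have hvs : StrictAnti v := strictAnti_add_rho hγ
  -- the staircase matrix
  set M : Matrix (Fin N) (Fin N) ℤ := Matrix.of fun i j => if v j ≤ u i then (1 : ℤ) else 0 with hM
  -- the signed count is `det M`
  have hdet : ∑ τ : Perm (Fin N), (Equiv.Perm.sign τ : ℤ) *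
      (if ∀ j, v (τ⁻¹ j) ≤ u j then 1 else 0) = M.det := by
    rw [Matrix.det_apply]
    refine Finset.sum_congr rfl fun τ _ => ?_
    rw [Units.smul_def, smul_eq_mul]
    congr 1
    have hprod : ∏ i, M (τ i) i = if ∀ i, v i ≤ u (τ i) then (1 : ℤ) else 0 := by
      simp only [hM, Matrix.of_apply]
      rw [Finset.prod_boole]
      simp only [Finset.mem_univ, true_implies]
    rw [hprod]
    have hiff : (∀ j, v (τ⁻¹ j) ≤ u j) ↔ ∀ i, v i ≤ u (τ i) := by
      constructor
      · intro h i
        simpa using h (τ i)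
      · intro h j
        simpa using h (τ⁻¹ j)
    by_cases h : ∀ j, v (τ⁻¹ j) ≤ u j
    · rw [if_pos h, if_pos (hiff.mp h)]
    · rw [if_neg h, if_neg (fun h' => h (hiff.mpr h'))]
  rw [hdet]
  -- the step function `c`
  set c : Fin N → ℕ := fun i => (univ.filter fun j' : Fin N => u i < v j').card with hc
  have hcle : ∀ i j : Fin N, v j ≤ u i ↔ c i ≤ (j : ℕ) := fun i j => le_iff_card_filter_le hvs (u i) j
  have hcN : ∀ i, c i ≤ N := fun i =>
    (Finset.card_le_univ _).trans (Fintype.card_fin N).le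
  have hcmono : Monotone c := by
    intro i i' hii'
    exact Finset.card_le_card fun j hj => by
      rw [Finset.mem_filter] at hj ⊢
      exact ⟨hj.1, lt_of_le_of_lt (hus.antitone hii') hj.2⟩
  have hMc : ∀ i j, M i j = if c i ≤ (j : ℕ) then 1 else 0 := by
    intro i j
    simp only [hM, Matrix.of_apply]
    by_cases h : v j ≤ u i
    · rw [if_pos h, if_pos ((hcle i j).mp h)]
    · rw [if_neg h, if_neg (fun h' => h ((hcle i j).mpr h'))]
  -- translation of the interlacing condition into `c = id`
  have hIL : (∀ i : Fin N, γ i ≤ lam i ∧ ∀ i' : Fin N, (i : ℕ) + 1 = i' → lam i' ≤ γ i) ↔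
      ∀ i : Fin N, c i = i := by
    constructor
    · intro h i
      apply le_antisymm
      · rw [← hcle]
        change γ i + rho N i ≤ lam i + rho N i
        exact Nat.add_le_add_right (h i).1 _
      · rcases Nat.eq_zero_or_pos (i : ℕ) with hi0 | hipos
        · rw [hi0]; exact Nat.zero_le _
        · have hi := i.2
          set i₀ : Fin N := ⟨(i : ℕ) - 1, by omega⟩ with hi₀
          have hi₀val : (i₀ : ℕ) = (i : ℕ) - 1 := rfl
          have hstep := (h i₀).2 i (by omega)
          -- `¬ (v i₀ ≤ u i)`, i.e. `¬ (c i ≤ i₀)`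
          have hlt : u i < v i₀ := by
            change lam i + rho N i < γ i₀ + rho N i₀
            rw [rho_apply, rho_apply]
            omega
          have := mt (hcle i i₀).mpr (not_le.mpr hlt)
          rw [not_le] at this
          omega
    · intro h i
      refine ⟨?_, fun i' hii' => ?_⟩
      · have := (hcle i i).mpr (h i).le
        change γ i + rho N i ≤ lam i + rho N i at this
        omega
      · have hi' := i'.2
        have hnot : ¬ c i' ≤ (i : ℕ) := by rw [h i']; omega
        rw [← hcle, not_le] at hnot
        change lam i' + rho N i' < γ i + rho N i at hnot
        rw [rho_apply, rho_apply] at hnot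
        omega
  by_cases hil : ∀ i : Fin N, γ i ≤ lam i ∧ ∀ i' : Fin N, (i : ℕ) + 1 = i' → lam i' ≤ γ i
  · rw [if_pos hil]
    have hcid := hIL.mp hil
    have htri : M.BlockTriangular id := by
      intro i j hij
      have hij' : (j : ℕ) < i := hij
      rw [hMc, if_neg]
      rw [hcid]
      exact not_le.mpr hij'
    rw [Matrix.det_of_upperTriangular htri]
    refine Finset.prod_eq_one fun i _ => ?_
    rw [hMc, hcid, if_pos le_rfl]
  · rw [if_neg hil]
    by_contra hne
    apply hil
    rw [hIL]
    -- no zero row: `c i < N`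
    have hclt : ∀ i, c i < N := by
      intro i
      by_contra hge
      have hci : c i = N := le_antisymm (hcN i) (not_lt.mp hge)
      apply hne
      refine Matrix.det_eq_zero_of_row_eq_zero i fun j => ?_
      rw [hMc, if_neg]
      rw [hci]
      exact not_le.mpr j.2
    -- distinct rows: `c` injective
    have hcinj : Function.Injective c := by
      intro i i' hii'
      by_contra hne'
      apply hne
      refine Matrix.det_zero_of_row_eq hne' ?_
      funext j
      rw [hMc, hMc, hii']
    -- hence `c` is a strictly monotone self-map of `Fin N`, the identity
    set c' : Fin N → Fin N := fun i => ⟨c i, hclt i⟩ with hc'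
    have hc'mono : StrictMono c' := by
      refine (show Monotone c' from fun i i' h => ?_).strictMono_of_injective ?_
      · exact Fin.mk_le_mk.mpr (hcmono h)
      · intro i i' h
        exact hcinj (congrArg Fin.val h)
    intro i
    exact eq_self_of_strictMono hc'mono i

end Staircase

/-! ### §4 The coefficient of `x^{λ+ρ}` in `a_{γ+ρ} · h_b` -/

section Coefficient

variable {N : ℕ}

/-- The coefficients of `h_b = ∑_{|c| = b} x^c` at the generic point: `[x^c] h_b = [|c| = b]`.
[cite: Macdonald1995, Ch. I §2 (complete symmetric functions)] -/
theorem coeff_sum_monomial_finsuppAntidiag (b : ℕ) (c : Fin N →₀ ℕ) :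
    coeff c (∑ c' ∈ (univ : Finset (Fin N)).finsuppAntidiag b, monomial c' (1 : ℤ)) =
      if c ∈ (univ : Finset (Fin N)).finsuppAntidiag b then 1 else 0 := by
  rw [coeff_sum]
  simp_rw [coeff_monomial]
  rw [Finset.sum_ite_eq']

/-- **`[x^{λ+ρ}] (a_{γ+ρ} · h_b) = ∑_{w ∈ 𝔖_N} sgn(w) [(γ+ρ)∘w⁻¹ ≤ λ+ρ] = [λ ↦ γ]`** for antitone
`γ, λ ∈ ℕ^N` with `|γ| + b = |λ|`: the coefficient form of Pieri's formula `s_γ h_b = ∑_{λ/γ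
horizontal b-strip} s_λ`, i.e. `a_{γ+ρ} h_b = ∑ a_{λ+ρ}` (Macdonald I (5.16)), obtained by expanding
the alternant (`coeff_alternant_mul`) — every `h_b`-coefficient met is `1` by degree count — and the
staircase determinant `sum_sign_mul_ite_le_eq`. [cite: Macdonald1995, Ch. I §5 (5.16)] -/
theorem coeff_alternant_add_rho_mul_hsum {γ lam : Fin N → ℕ} (hγ : Antitone γ) (hlam : Antitone lam)
    {b : ℕ} (hsum : ∑ i, γ i + b = ∑ i, lam i) :
    coeff (Finsupp.equivFunOnFinite.symm (lam + rho N))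
        (alternant (fun i => (X i : MvPolynomial (Fin N) ℤ)) (γ + rho N) *
          ∑ c' ∈ (univ : Finset (Fin N)).finsuppAntidiag b, monomial c' (1 : ℤ)) =
      if (∀ i : Fin N, γ i ≤ lam i ∧ ∀ i' : Fin N, (i : ℕ) + 1 = i' → lam i' ≤ γ i) then 1 else 0 := by
  classical
  rw [coeff_alternant_mul, ← sum_sign_mul_ite_le_eq hγ hlam]
  refine Finset.sum_congr rfl fun τ _ => ?_
  congr 1
  set e : Fin N →₀ ℕ := Finsupp.equivFunOnFinite.symm (lam + rho N) with he
  set vτ : Fin N →₀ ℕ := Finsupp.equivFunOnFinite.symm fun j => (γ + rho N) (τ⁻¹ j) with hvτ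
  have hiff : vτ ≤ e ↔ ∀ j, (γ + rho N) (τ⁻¹ j) ≤ (lam + rho N) j := by
    rw [Finsupp.le_def]
    simp only [hvτ, he, Finsupp.coe_equivFunOnFinite_symm]
  by_cases hle : vτ ≤ e
  · rw [if_pos hle, if_pos (hiff.mp hle), coeff_sum_monomial_finsuppAntidiag, if_pos]
    rw [Finset.mem_finsuppAntidiag]
    refine ⟨?_, Finset.subset_univ _⟩
    -- degree count: `|e - vτ| = |λ| + |ρ| - (|γ| + |ρ|) = b`
    have hpt : ∀ j, vτ j ≤ e j := fun j => hle j
    have h1 : ∑ j, (e - vτ) j + ∑ j, vτ j = ∑ j, e j := by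
      rw [← Finset.sum_add_distrib]
      exact Finset.sum_congr rfl fun j _ => by rw [Finsupp.tsub_apply]; exact Nat.sub_add_cancel (hpt j)
    have h2 : ∑ j, vτ j = ∑ i, γ i + ∑ i, rho N i := by
      simp only [hvτ, Finsupp.coe_equivFunOnFinite_symm]
      rw [Equiv.sum_comp τ⁻¹ (γ + rho N)]
      exact Finset.sum_add_distrib
    have h3 : ∑ j, e j = ∑ i, lam i + ∑ i, rho N i := by
      simp only [he, Finsupp.coe_equivFunOnFinite_symm]
      exact Finset.sum_add_distrib
    show ∑ j, (e - vτ) j = b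
    omega
  · rw [if_neg hle, if_neg (fun h => hle (hiff.mpr h))]

end Coefficient

/-! ### §5 Assembly for Frobenius's coefficients -/

section Frobenius

variable {N : ℕ}

/-- **Pieri's rule for Frobenius's coefficients.** For an antitone `λ ∈ ℕ^N` with `|λ| = a + b` and
`σ ∈ 𝔖_a`: `∑_{ρ ∈ 𝔖_b} X^λ(σ ⊔ ρ) = b! · ∑_{γ ∈ ℕ^N antitone, |γ| = a, λ ↦ γ} X^γ(σ)`, where
`X^λ(τ) = [x^{λ+ρ}](a_ρ F_τ)` (`frobeniusChar`): by §1–§2 the left side is `b! · [x^{λ+ρ}](a_ρ F_σ h_b)`,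
by the alternant expansion `a_ρ F_σ = ∑_γ X^γ(σ) a_{γ+ρ}` (`alternant_mul_fixedWordPoly_eq_sum`) and §4
this is the right side. Macdonald I (5.16) with (7.3). [cite: Macdonald1995, Ch. I §5 (5.16) and §7 (7.3)] -/
theorem sum_frobeniusChar_sumCongr {a b : ℕ} (lam : Fin N → ℕ) (hlam : Antitone lam)
    (hsum : ∑ i, lam i = a + b) (σ : Perm (Fin a)) :
    ∑ ρ : Perm (Fin b), frobeniusChar N lam (σ.sumCongr ρ) =
      (b.factorial : ℤ) * ∑ γ ∈ antitoneWeights N a,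
        (if (∀ i : Fin N, γ i ≤ lam i ∧ ∀ i' : Fin N, (i : ℕ) + 1 = i' → lam i' ≤ γ i)
          then frobeniusChar N γ σ else 0) := by
  classical
  set e : Fin N →₀ ℕ := Finsupp.equivFunOnFinite.symm (lam + rho N) with he
  set Q : MvPolynomial (Fin N) ℤ :=
    alternant (fun i => (X i : MvPolynomial (Fin N) ℤ)) (rho N) * fixedWordPoly N σ with hQ
  set Hb : MvPolynomial (Fin N) ℤ :=
    ∑ c' ∈ (univ : Finset (Fin N)).finsuppAntidiag b, monomial c' (1 : ℤ) with hHb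
  -- §1: `X^λ(σ ⊔ ρ) = [x^e] (Q · F_ρ)`
  have h1 : ∀ ρ : Perm (Fin b), frobeniusChar N lam (σ.sumCongr ρ) = coeff e (Q * fixedWordPoly N ρ) := by
    intro ρ
    rw [frobeniusChar_def, fixedWordPoly_sumCongr, ← mul_assoc]
  simp_rw [h1]
  -- §2: sum over `ρ`
  rw [← coeff_sum, ← Finset.mul_sum, sum_fixedWordPoly_eq_factorial_mul, mul_left_comm, coeff_C_mul]
  congr 1
  -- the alternant expansion and §4
  rw [hQ, alternant_mul_fixedWordPoly_eq_sum, Fintype.card_fin, Finset.sum_mul, coeff_sum]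
  refine Finset.sum_congr rfl fun γ hγ => ?_
  obtain ⟨hγsum, hγanti⟩ := mem_antitoneWeights.mp hγ
  rw [mul_assoc, coeff_C_mul, he, coeff_alternant_add_rho_mul_hsum hγanti hlam (by rw [hγsum, hsum]),
    mul_ite, mul_one, mul_zero]

end Frobenius

/-! ### §6 Pieri's rule for the Specht characters -/

section Specht

/-- A partition of `D` has at most `D` parts (all parts are positive). [folklore] -/
private theorem card_parts_le_size {D : ℕ} (μ : Nat.Partition D) : μ.parts.card ≤ D := by
  have h := Multiset.card_nsmul_le_sum (s := μ.parts) (a := 1) (fun x hx => μ.parts_pos hx)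
  rw [μ.parts_sum] at h
  simpa using h

/-- The padded parts vector `(μ₁, …, μ_ℓ, 0, …, 0) ∈ ℕ^N` of a partition `μ ⊢ d` with at most `N`
parts is an antitone weight of size `d` (Macdonald I §1: a partition is a weakly decreasing sequence of
non-negative integers with finitely many non-zero terms, identified with its zero-paddings).
[cite: Macdonald1995, Ch. I §1 (partitions as decreasing sequences)] -/
theorem getD_sortedParts_mem_antitoneWeights {N d : ℕ} (μ : Nat.Partition d) (hμ : μ.parts.card ≤ N) :
    (fun i : Fin N => μ.sortedParts.getD i 0) ∈ antitoneWeights N d :=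
  mem_antitoneWeights.mpr ⟨sum_getD_sortedParts μ hμ, getD_sortedParts_antitone μ⟩

/-- An antitone weight `γ ∈ ℕ^N` of size `d` is the padded parts vector of a partition of `d` with at
most `N` parts (existence half of the tree's `Weight.existsUnique_eq_ofPartition`; Macdonald I §1).
[cite: Macdonald1995, Ch. I §1 (partitions as decreasing sequences)] -/
theorem exists_partition_of_mem_antitoneWeights' {N d : ℕ} {γ : Fin N → ℕ}
    (hγ : γ ∈ antitoneWeights N d) :
    ∃ μ : Nat.Partition d, μ.parts.card ≤ N ∧ (fun i : Fin N => μ.sortedParts.getD i 0) = γ := by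
  rw [mem_antitoneWeights] at hγ
  obtain ⟨hsum, hanti⟩ := hγ
  have hχ : Weight.IsPolynomial (fun i => (γ i : ℤ) : Weight (Fin N)) :=
    ⟨fun i j hij => Int.ofNat_le.mpr (hanti hij), fun i => Int.natCast_nonneg (γ i)⟩
  obtain ⟨μ, ⟨hμN, hμχ⟩, -⟩ := Weight.existsUnique_eq_ofPartition_holds hχ
  have hsize : (Weight.size (fun i => (γ i : ℤ) : Weight (Fin N))).toNat = d := by
    simp only [Weight.size]
    rw [← Nat.cast_sum, hsum, Int.toNat_natCast]
  have hget : ∀ i : Fin N, μ.sortedParts.getD (i : ℕ) 0 = γ i := fun i => by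
    have := congrFun hμχ i
    rw [Weight.ofPartition_apply] at this
    exact_mod_cast this
  exact ⟨⟨μ.parts, μ.parts_pos, by rw [μ.parts_sum, hsize]⟩, hμN, funext hget⟩

/-- Two partitions with at most `N` parts and the same padded parts vector in `ℕ^N` are equal
(the tree's `Weight.ofPartition_injOn`; Macdonald I §1).
[cite: Macdonald1995, Ch. I §1 (partitions as decreasing sequences)] -/
theorem eq_of_getD_sortedParts_eq {N d : ℕ} {μ μ' : Nat.Partition d} (hμ : μ.parts.card ≤ N)
    (hμ' : μ'.parts.card ≤ N)
    (h : (fun i : Fin N => μ.sortedParts.getD i 0) = fun i : Fin N => μ'.sortedParts.getD i 0) :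
    μ = μ' := by
  refine Weight.ofPartition_injOn_holds N d hμ hμ' ?_
  funext i
  rw [Weight.ofPartition_apply, Weight.ofPartition_apply]
  exact_mod_cast congrFun h i

/-- The interlacing relation `π ↦ π'` (`π₁ ≥ π'₁ ≥ π₂ ≥ π'₂ ≥ ⋯ ≥ 0`, all parts padded by zeros) for
`π ⊢ D` with at most `N` parts, read on the padded parts vectors in `ℕ^N`. [cite: BurgisserEtAl2011, Prop. 4.5.4] -/
theorem interlaces_iff_fin {N D a : ℕ} (π : Nat.Partition D) (hπ : π.parts.card ≤ N)
    (π' : Nat.Partition a) (hπ' : π'.parts.card ≤ N) :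
    (∀ i : ℕ, π'.sortedParts.getD i 0 ≤ π.sortedParts.getD i 0 ∧
        π.sortedParts.getD (i + 1) 0 ≤ π'.sortedParts.getD i 0) ↔
      ∀ i : Fin N, π'.sortedParts.getD i 0 ≤ π.sortedParts.getD i 0 ∧
        ∀ i' : Fin N, (i : ℕ) + 1 = i' → π.sortedParts.getD i' 0 ≤ π'.sortedParts.getD i 0 := by
  constructor
  · intro h i
    exact ⟨(h i).1, fun i' hii' => by rw [← hii']; exact (h i).2⟩
  · intro h i
    have hπ0 : ∀ j : ℕ, N ≤ j → π.sortedParts.getD j 0 = 0 := fun j hj =>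
      List.getD_eq_default _ _ (by rw [Nat.Partition.length_sortedParts]; omega)
    have hπ'0 : ∀ j : ℕ, N ≤ j → π'.sortedParts.getD j 0 = 0 := fun j hj =>
      List.getD_eq_default _ _ (by rw [Nat.Partition.length_sortedParts]; omega)
    by_cases hi : i < N
    · refine ⟨(h ⟨i, hi⟩).1, ?_⟩
      by_cases hi1 : i + 1 < N
      · exact (h ⟨i, hi⟩).2 ⟨i + 1, hi1⟩ rfl
      · rw [hπ0 (i + 1) (not_lt.mp hi1)]
        exact Nat.zero_le _
    · rw [hπ'0 i (not_lt.mp hi), hπ0 (i + 1) (by omega)]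
      exact ⟨Nat.zero_le _, le_rfl⟩

open Classical in
/-- **Pieri's rule for the characters of the symmetric groups (pointwise branching form).** For a
partition `π ⊢ D`, a splitting `e : [a] ⊔ [b] ≃ [D]` of the positions and `σ ∈ 𝔖_a`:

  `∑_{ρ ∈ 𝔖_b} χ^π(e (σ ⊔ ρ) e⁻¹) = b! · ∑_{π' ⊢ a, π ↦ π'} χ^{π'}(σ)`,

the sum on the right running over the partitions `π'` of `a` interlaced by `π`
(`π₁ ≥ π'₁ ≥ π₂ ≥ π'₂ ≥ ⋯`, i.e. `π' ⊂ π` with `π/π'` a horizontal strip). Equivalently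
`⟨Res_{𝔖_a × 𝔖_b} χ^π, χ^{π'} ⊠ 1⟩ = [π ↦ π']`, the character form of Pieri's formula
`[π'] ∘ [b] = Ind_{𝔖_a × 𝔖_b}^{𝔖_{a+b}} ([π'] ⊠ 1) = ⊕_{π/π' horizontal strip} [π]` (Macdonald I (5.16)
with (7.3); Fulton–Harris Cor. 4.39 / (4.44); for `b = 1` the branching theorem, James 9.2).
Proof: Frobenius's formula in `D` letters for `π` and for every `π' ⊢ a` (§5, §6).
[cite: Macdonald1995, Ch. I §5 (5.16) and §7 (7.3)] -/
theorem sum_spechtCharacter_permCongr_sumCongr {a b D : ℕ} (e : Fin a ⊕ Fin b ≃ Fin D)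
    (π : Nat.Partition D) (σ : Perm (Fin a)) :
    ∑ ρ : Perm (Fin b), spechtCharacter ℂ π (e.permCongr (σ.sumCongr ρ)) =
      (b.factorial : ℂ) * ∑ π' ∈ (univ : Finset (Nat.Partition a)).filter
        (fun π' => ∀ i : ℕ, π'.sortedParts.getD i 0 ≤ π.sortedParts.getD i 0 ∧
          π.sortedParts.getD (i + 1) 0 ≤ π'.sortedParts.getD i 0),
        spechtCharacter ℂ π' σ := by
  have hD : a + b = D := by
    have := Fintype.card_congr e
    simpa using this
  have hπD : π.parts.card ≤ D := card_parts_le_size π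
  set lam : Fin D → ℕ := fun i => π.sortedParts.getD i 0 with hlam
  -- left side through Frobenius's formula in `D` letters
  have hL : ∀ ρ : Perm (Fin b), spechtCharacter ℂ π (e.permCongr (σ.sumCongr ρ)) =
      (frobeniusChar D lam (σ.sumCongr ρ) : ℂ) := fun ρ => by
    rw [spechtCharacter_eq_frobeniusChar π hπD, frobeniusChar_permCongr]
  simp_rw [hL]
  rw [← Int.cast_sum, sum_frobeniusChar_sumCongr lam (getD_sortedParts_antitone π)
    (by rw [sum_getD_sortedParts π hπD, hD]) σ, Int.cast_mul, Int.cast_natCast]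
  congr 1
  rw [Int.cast_sum, Finset.sum_filter]
  -- re-index the antitone weights of size `a` by the partitions of `a` (all have `≤ a ≤ D` parts)
  have hcard : ∀ π' : Nat.Partition a, π'.parts.card ≤ D := fun π' =>
    (card_parts_le_size π').trans (by omega)
  symm
  refine Finset.sum_bij (fun (π' : Nat.Partition a) _ => fun i : Fin D => π'.sortedParts.getD i 0)
    (fun π' _ => getD_sortedParts_mem_antitoneWeights π' (hcard π'))
    (fun π₁ _ π₂ _ h => eq_of_getD_sortedParts_eq (hcard π₁) (hcard π₂) h)
    (fun γ hγ => ?_) (fun π' _ => ?_)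
  · obtain ⟨μ, hμ, hμγ⟩ := exists_partition_of_mem_antitoneWeights' hγ
    exact ⟨μ, Finset.mem_univ _, hμγ⟩
  · rw [interlaces_iff_fin π hπD π' (hcard π')]
    by_cases h : ∀ i : Fin D, π'.sortedParts.getD i 0 ≤ π.sortedParts.getD i 0 ∧
        ∀ i' : Fin D, (i : ℕ) + 1 = i' → π.sortedParts.getD i' 0 ≤ π'.sortedParts.getD i 0
    · rw [if_pos h, if_pos h, spechtCharacter_eq_frobeniusChar π' (hcard π')]
    · rw [if_neg h, if_neg h, Int.cast_zero]

open Classical in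
/-- **Pieri's rule, summed against a class function** (the form consumed by invariant-dimension
counts): for any `f : 𝔖_a → ℂ`,
`∑_{σ ∈ 𝔖_a} ∑_{ρ ∈ 𝔖_b} χ^π(e (σ ⊔ ρ) e⁻¹) f(σ) = b! · ∑_{π' ⊢ a, π ↦ π'} ∑_σ χ^{π'}(σ) f(σ)`.
[cite: Macdonald1995, Ch. I §5 (5.16) and §7 (7.3)] -/
theorem sum_sum_spechtCharacter_permCongr_sumCongr_mul {a b D : ℕ} (e : Fin a ⊕ Fin b ≃ Fin D)
    (π : Nat.Partition D) (f : Perm (Fin a) → ℂ) :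
    ∑ σ : Perm (Fin a), ∑ ρ : Perm (Fin b),
        spechtCharacter ℂ π (e.permCongr (σ.sumCongr ρ)) * f σ =
      (b.factorial : ℂ) * ∑ π' ∈ (univ : Finset (Nat.Partition a)).filter
        (fun π' => ∀ i : ℕ, π'.sortedParts.getD i 0 ≤ π.sortedParts.getD i 0 ∧
          π.sortedParts.getD (i + 1) 0 ≤ π'.sortedParts.getD i 0),
        ∑ σ : Perm (Fin a), spechtCharacter ℂ π' σ * f σ := by
  classical
  simp_rw [← Finset.sum_mul, sum_spechtCharacter_permCongr_sumCongr e π, mul_assoc, ← Finset.mul_sum,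
    Finset.sum_mul]
  rw [Finset.sum_comm]

end Specht

end Literature.RepresentationTheory.FiniteGroups

end
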